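import Summits.HubbardSuperconductivity.HubbardSuperconductivity.Theorems.AnisotropyChordConcavityOneMagnonSector

/-!
# Route `AnisotropyChord`: the hopping formula for the spin-½ XXZ Hamiltonian on an arbitrary
# configuration (hard-core boson form; toolkit for sector-by-sector computations — any filling)

For `H(Δ) = xxzHamiltonian 1 G (−1) Δ` on a finite simple graph and ANY basis configuration `σ`
(`σ_x = 1` = down spin = boson), with `Z(σ) = Σ_{xy∈E}(½ − σ_x)(½ − σ_y)`:

  `(H(Δ)ψ)(σ) = −Δ·Z(σ)·ψ(σ) − ½ · Σ_{{x,y} ∈ E, σ_x ≠ σ_y} ψ(σ ∘ swap_{xy})`      (`xxz_mulVec_apply`)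

— diagonal Ising weight plus nearest-neighbour hops of the bosons (`σ ∘ Equiv.swap x y` exchanges the
occupations of `x` and `y`).  Ingredients: `H(Δ) = −H_Heis(1) + (1−Δ)·diag Z` (`…OneMagnonSector`),
`𝐒_x·𝐒_y = SᶻSᶻ + ½(S⁺S⁻ + S⁻S⁺)` (`LiebMattis.spinDot_eq_of_ne`) and the single-site action
`LiebMattis.onSite_mulVec_apply`.  Used for the two-magnon sector (`…TwoMagnon*`).  H. Tasaki (2020)
§2.2 eq. (2.2.5), §2.4.  No definition is introduced.
-/

set_option linter.dupNamespace false

noncomputable section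

namespace Summit.HubbardSuperconductivity.HubbardSuperconductivity.Theorems.AnisotropyChord.OneMagnon

open Matrix Complex Finset
open Literature.MathematicalPhysics.QuantumLattice

variable {V : Type*} [Fintype V] [DecidableEq V]

/-- **`S⁺_x S⁻_y` hops a boson from `y` to `x`**: `((S⁺_x S⁻_y)ψ)(σ) = [σ_x = 0][σ_y = 1]·ψ(σ ∘ swap_{xy})`
(`x ≠ y`, spin ½). [folklore] -/
theorem raise_lower_mulVec_apply {x y : V} (hxy : x ≠ y) (ψ : (V → Fin 2) → ℂ) (σ : V → Fin 2) :
    ((onSite x (spinRaise 1) * onSite y (spinLower 1) : Op V 2) *ᵥ ψ) σ =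
      if σ x = 0 ∧ σ y = 1 then ψ (σ ∘ Equiv.swap x y) else 0 := by
  have fin_two_eq_zero_or_one : ∀ t : Fin 2, t = 0 ∨ t = 1 := by decide
  have hR : ∀ k l : Fin 2, spinRaise 1 k l = if k = 0 ∧ l = 1 then 1 else 0 := by
    intro k l
    rcases fin_two_eq_zero_or_one k with rfl | rfl <;> rcases fin_two_eq_zero_or_one l with rfl | rfl <;>
      · rw [spinRaise_apply]; norm_num
  have hL : ∀ k l : Fin 2, spinLower 1 k l = if k = 1 ∧ l = 0 then 1 else 0 := by
    intro k l
    rcases fin_two_eq_zero_or_one k with rfl | rfl <;> rcases fin_two_eq_zero_or_one l with rfl | rfl <;>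
      · rw [spinLower_apply]; norm_num
  -- the configuration after the hop
  have hcfg : σ x = 0 → σ y = 1 →
      Function.update (Function.update σ x 1) y 0 = σ ∘ Equiv.swap x y := by
    intro hx hy
    funext z
    simp only [Function.comp_apply]
    by_cases hzx : z = x
    · subst hzx
      rw [Equiv.swap_apply_left, Function.update_of_ne hxy, Function.update_self, hy]
    · by_cases hzy : z = y
      · subst hzy
        rw [Equiv.swap_apply_right, Function.update_self, hx]
      · rw [Equiv.swap_apply_of_ne_of_ne hzx hzy, Function.update_of_ne hzy, Function.update_of_ne hzx]
  rw [← Matrix.mulVec_mulVec, LiebMattis.onSite_mulVec_apply, Fin.sum_univ_two, hR, hR,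
    LiebMattis.onSite_mulVec_apply, LiebMattis.onSite_mulVec_apply, Fin.sum_univ_two, Fin.sum_univ_two, hL, hL, hL, hL,
    Function.update_of_ne (Ne.symm hxy), Function.update_of_ne (Ne.symm hxy)]
  by_cases hx : σ x = 0
  · by_cases hy : σ y = 1
    · rw [hcfg hx hy]; simp [hx, hy]
    · simp [hx, hy]
  · simp [hx]

/-- **Hopping formula for the spin-½ XXZ Hamiltonian** on an arbitrary configuration:
`(H(Δ)ψ)(σ) = −Δ·Z(σ)·ψ(σ) − ½ Σ_{{x,y}∈E, σ_x ≠ σ_y} ψ(σ ∘ swap_{xy})`. Tasaki (2020) §2.4.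
[folklore] -/
theorem xxz_mulVec_apply (G : SimpleGraph V) [DecidableRel G.Adj] (Δ : ℝ)
    (ψ : (V → Fin 2) → ℂ) (σ : V → Fin 2) :
    ((xxzHamiltonian 1 G (-1) Δ : Op V 2) *ᵥ ψ) σ =
      -((Δ * ∑ e ∈ G.edgeFinset, Sym2.lift ⟨fun x y => ((1 : ℝ) / 2 - (σ x : ℕ)) * ((1 : ℝ) / 2 - (σ y : ℕ)),
          fun _ _ => mul_comm _ _⟩ e : ℝ) : ℂ) * ψ σ
        - (1 / 2 : ℂ) * ∑ e ∈ G.edgeFinset,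
            Sym2.lift ⟨fun x y => if σ x ≠ σ y then ψ (σ ∘ Equiv.swap x y) else 0, fun x y => by
              simp only [ne_comm, Equiv.swap_comm]⟩ e := by
  -- split `H(Δ) = −H_Heis(1) + (1 − Δ)·diag Z`
  rw [xxz_eq_neg_heisenberg_add_diagonal, Matrix.add_mulVec, Matrix.neg_mulVec, Pi.add_apply, Pi.neg_apply,
    Matrix.mulVec_diagonal]
  -- the Heisenberg part, edge by edge
  have hheis : ((heisenbergHamiltonian 1 G 1 : Op V 2) *ᵥ ψ) σ =
      ((∑ e ∈ G.edgeFinset, Sym2.lift ⟨fun x y => ((1 : ℝ) / 2 - (σ x : ℕ)) * ((1 : ℝ) / 2 - (σ y : ℕ)),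
          fun _ _ => mul_comm _ _⟩ e : ℝ) : ℂ) * ψ σ
        + (1 / 2 : ℂ) * ∑ e ∈ G.edgeFinset,
            Sym2.lift ⟨fun x y => if σ x ≠ σ y then ψ (σ ∘ Equiv.swap x y) else 0, fun x y => by
              simp only [ne_comm, Equiv.swap_comm]⟩ e := by
    rw [heisenbergHamiltonian]
    push_cast
    rw [one_smul, Matrix.sum_mulVec, Finset.sum_apply, Finset.sum_mul, Finset.mul_sum, ← Finset.sum_add_distrib]
    refine Finset.sum_congr rfl fun e he => ?_
    revert he
    induction e using Sym2.ind with
    | h x y =>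
      intro he
      rw [SimpleGraph.mem_edgeFinset, SimpleGraph.mem_edgeSet] at he
      have hxy : x ≠ y := he.ne
      simp only [Sym2.lift_mk, spinDotSym_mk]
      rw [LiebMattis.spinDot_eq_of_ne 1 hxy, Matrix.add_mulVec, Matrix.smul_mulVec, Matrix.add_mulVec,
        Pi.add_apply, Pi.smul_apply, Pi.add_apply, raise_lower_mulVec_apply hxy]
      -- the `S⁻_x S⁺_y` term is the `S⁺_y S⁻_x` term
      have hcomm : (onSite x (spinLower 1) * onSite y (spinRaise 1) : Op V 2) =
          onSite y (spinRaise 1) * onSite x (spinLower 1) :=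
        onSite_mul_onSite_comm hxy _ _
      rw [hcomm, raise_lower_mulVec_apply (Ne.symm hxy)]
      -- the `SᶻSᶻ` term is diagonal
      have hzz : ((onSite x (SpinOperators.spinZ 1) * onSite y (SpinOperators.spinZ 1) : Op V 2) *ᵥ ψ) σ =
          (((1 : ℂ) / 2 - ((σ x : ℕ) : ℂ)) * ((1 : ℂ) / 2 - ((σ y : ℕ) : ℂ))) * ψ σ := by
        rw [SpinOperators.spinZ, LiebMattis.onSite_diagonal, LiebMattis.onSite_diagonal, diagonal_mul_diagonal,
          mulVec_diagonal]
        simp only [Nat.cast_one]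
      rw [hzz, smul_eq_mul]
      push_cast
      -- case analysis on the two occupations
      have fin_two_eq_zero_or_one : ∀ t : Fin 2, t = 0 ∨ t = 1 := by decide
      rw [Equiv.swap_comm y x]
      rcases fin_two_eq_zero_or_one (σ x) with hx | hx <;> rcases fin_two_eq_zero_or_one (σ y) with hy | hy <;>
        simp [hx, hy]
  rw [hheis]
  push_cast
  ring

end Summit.HubbardSuperconductivity.HubbardSuperconductivity.Theorems.AnisotropyChord.OneMagnon
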